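import Summits.KontsevichZagierPeriods.KontsevichZagierPeriods.Theorems.SymplecticScissorsRealOnePeriodRelationsStubTorsUnitCore
import Literature.NumberTheory.Transcendental.CurvePeriodsEllipticTranslationProofs
import Mathlib.Analysis.Analytic.Order
import Mathlib.FieldTheory.AlgebraicClosure
import Mathlib.LinearAlgebra.FiniteDimensional.Lemmas
import Mathlib.LinearAlgebra.Matrix.ToLin

/-!
# `RealOnePeriodRelations` (stmt-KontsevichZagierPeriods-10042), line `nash-retraction-thin-strip`,
# reshape 10 (the torsion layer): the stub `stub_torsPolyExists`

`TorsionLayer.stub_torsPolyExists`: for a period pair `L` with `g₂, g₃ ∈ ℚ̄`, an algebraic point `v`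
of `E_L : y² = x³ − (g₂/4)x − g₃/4` (uniformised by `φ(z) = (℘ z, ℘′ z/2)`) and `N ≥ 2`, there is
`G ∈ ℚ̄[x, y]` whose pull-back `z ↦ G(φ z)` is not identically zero off `Λ`, has a pole of order
`≤ N` at `0` and vanishes to order `≥ N − 1` at `v`.  Linear algebra over `ℚ̄` + Taylor, no divisor
theory: the `N` monomials `xᵃ` (`2a ≤ N`), `xᵃ y` (`2a + 3 ≤ N`) pull back to germs `u(z)/z^n` with
the pairwise distinct pole orders `n = 0, 2, 3, …, N` at `0` (`z²℘` and `z³℘′/2` are regular at `0`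
with values `1`, `−1`), so a non-trivial combination is not identically zero (the vanishing order of a
sum of germs with distinct orders is the minimum); the `k`-th derivative of `z ↦ G(φ z)` is
`(Dᵏ G)(φ z)` for the derivation `D = 2y ∂ₓ + (3x² + A) ∂_y`, which preserves `ℚ̄`-coefficients, so
the `N − 1` Taylor conditions at `v` are `ℚ̄`-linear in the `N` coefficients and have a non-zero
solution over the field `algebraicClosure ℚ ℂ` (rank–nullity); finally `ord f′ + 1 = ord f` at a zero.
Analyticity of `z ↦ G(φ z)` off `Λ` and the chain rule along `φ` are the tree's
`TorsionLayer.analyticAt_eval_phi`, `TorsionLayer.hasDerivAt_eval_phi` (`…StubTorsUnitCore.lean`).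

References: Whittaker–Watson, *A Course of Modern Analysis* (1927), §20.5; Silverman, *AEC* III.3.5.
-/

noncomputable section

open scoped BigOperators Topology PeriodPair
open Set Filter MvPolynomial Complex Literature.NumberTheory.Transcendental
  Literature.NumberTheory.Transcendental.CurvePeriods Literature.NumberTheory.Transcendental.CurvePeriods.Ell

namespace Summit.KontsevichZagierPeriods.SymplecticScissors.RealOnePeriodRelations

namespace TorsionLayer

namespace TorsPoly

variable (L : PeriodPair)

/-! ### The derivation `D = 2y ∂ₓ + (3x² + A) ∂_y` and the Taylor conditions along `φ` -/

/-- **The derivation `D = 2y ∂ₓ + (3x² + A) ∂_y`** of `ℂ[x, y]`: a `ℂ`-linear operator preserving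
`ℚ̄`-coefficients (when `g₂ ∈ ℚ̄`) with `d/dz G(φ z) = (D G)(φ z)` off `Λ`
(`φ′ = (℘′, 3℘² − g₂/4) = (2y, 3x² + A) ∘ φ`). [folklore] -/
theorem exists_opD (h₂ : IsAlgebraic ℚ L.g₂) :
    ∃ D : MvPolynomial (Fin 2) ℂ →ₗ[ℂ] MvPolynomial (Fin 2) ℂ,
      (∀ p, HasAlgCoeffs p → HasAlgCoeffs (D p)) ∧
      ∀ p, ∀ z : ℂ, z ∉ L.lattice →
        HasDerivAt (fun w => eval (phi L w) p) (eval (phi L z) (D p)) z := by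
  set E : Fin 2 → MvPolynomial (Fin 2) ℂ := ![C 2 * X 1, C 3 * X 0 ^ 2 + C (A L)] with hE
  have hEalg : ∀ k, HasAlgCoeffs (E k) := by
    rw [Fin.forall_fin_two]
    exact ⟨(hasAlgCoeffs_C (isAlgebraic_nat 2)).mul (hasAlgCoeffs_X 1),
      ((hasAlgCoeffs_C (isAlgebraic_nat 3)).mul ((hasAlgCoeffs_X 0).pow 2)).add
        (hasAlgCoeffs_C (isAlgebraic_A L h₂))⟩
  have hEeval : ∀ (z : ℂ) (k : Fin 2), eval (phi L z) (E k) = phiD L z k := by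
    intro z k
    fin_cases k
    · simp [hE]
      ring
    · simp [hE, A]
      ring
  refine ⟨{ toFun := fun p => ∑ k : Fin 2, pderiv k p * E k
            map_add' := fun p q => by simp only [map_add, add_mul, Finset.sum_add_distrib]
            map_smul' := fun c p => by
              simp only [RingHom.id_apply, Finset.smul_sum, (pderiv _).map_smul,
                smul_mul_assoc] },
    fun p hp => hasAlgCoeffs_finsetSum _ _ fun k _ => (hp.pderiv k).mul (hEalg k),
    fun p z hz => ?_⟩
  simp only [LinearMap.coe_mk, AddHom.coe_mk, map_sum, map_mul, hEeval]
  exact hasDerivAt_eval_phi L p hz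

/-- Iterates of a coefficient-preserving operator preserve `ℚ̄`-coefficients. [folklore] -/
theorem hasAlgCoeffs_pow_apply {D : MvPolynomial (Fin 2) ℂ →ₗ[ℂ] MvPolynomial (Fin 2) ℂ}
    (hD : ∀ p, HasAlgCoeffs p → HasAlgCoeffs (D p)) {p : MvPolynomial (Fin 2) ℂ}
    (hp : HasAlgCoeffs p) : ∀ k : ℕ, HasAlgCoeffs ((D ^ k) p)
  | 0 => by simpa using hp
  | k + 1 => by
    rw [pow_succ', Module.End.mul_apply]
    exact hD _ (hasAlgCoeffs_pow_apply hD hp k)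

/-- **Taylor conditions**: if `D` lifts `d/dz` along `φ` and `(Dᵏ G)(φ v) = 0` for all `k < n`,
then `z ↦ G(φ z)` vanishes to order `≥ n` at `v ∉ Λ` (induction on `n`:
`ord (f′) + 1 = ord f` at a zero, `Mathlib`'s `AnalyticAt.analyticOrderAt_deriv_add_one`).
[folklore] -/
theorem le_analyticOrderAt_eval_phi {D : MvPolynomial (Fin 2) ℂ →ₗ[ℂ] MvPolynomial (Fin 2) ℂ}
    (hD : ∀ p, ∀ z : ℂ, z ∉ L.lattice →
      HasDerivAt (fun w => eval (phi L w) p) (eval (phi L z) (D p)) z)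
    {v : ℂ} (hv : v ∉ L.lattice) (n : ℕ) (p : MvPolynomial (Fin 2) ℂ)
    (h : ∀ k < n, eval (phi L v) ((D ^ k) p) = 0) :
    (n : ℕ∞) ≤ analyticOrderAt (fun w => eval (phi L w) p) v := by
  induction n generalizing p with
  | zero => simp
  | succ n ih =>
    have h0 : eval (phi L v) p = 0 := by simpa using h 0 (Nat.succ_pos n)
    have h1 : (n : ℕ∞) ≤ analyticOrderAt (fun w => eval (phi L w) (D p)) v := by
      refine ih (D p) fun k hk => ?_
      have := h (k + 1) (by omega)
      rwa [pow_succ, Module.End.mul_apply] at this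
    have hderiv : deriv (fun w => eval (phi L w) p) =ᶠ[𝓝 v] fun w => eval (phi L w) (D p) := by
      filter_upwards [L.isClosed_lattice.isOpen_compl.mem_nhds hv] with w hw
      exact (hD p w hw).deriv
    have key := (analyticAt_eval_phi L p hv).analyticOrderAt_deriv_add_one
    simp only [h0, sub_zero] at key
    rw [← key, analyticOrderAt_congr hderiv, Nat.cast_succ]
    exact add_le_add h1 le_rfl

/-! ### Poles at `0`: the regular germs of `z²℘`, `z³℘′/2` and the monomials `xᵃ yᵇ` -/

/-- **`℘ = P/z²`, `℘′/2 = Q/z³` near `0`** with `P = 1 + z² ℘[Λ − 0]`, `Q = −1 + z³ ℘′[Λ − 0]/2`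
regular at `0`, `P(0) = 1`, `Q(0) = −1` (Mathlib: `PeriodPair.weierstrassPExcept_add`,
`PeriodPair.derivWeierstrassPExcept_sub`). [folklore] -/
theorem exists_germs : ∃ P Q : ℂ → ℂ, AnalyticAt ℂ P 0 ∧ AnalyticAt ℂ Q 0 ∧ P 0 = 1 ∧ Q 0 = -1 ∧
    ∀ z : ℂ, z ≠ 0 → ℘[L] z = P z / z ^ 2 ∧ ℘'[L] z / 2 = Q z / z ^ 3 := by
  refine ⟨fun z => z ^ 2 * L.weierstrassPExcept 0 z + 1,
    fun z => z ^ 3 * L.derivWeierstrassPExcept 0 z / 2 - 1, by fun_prop, by fun_prop, by simp,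
    by simp, fun z hz => ⟨?_, ?_⟩⟩
  · have h := L.weierstrassPExcept_add ⟨0, zero_mem _⟩ z
    simp only [sub_zero] at h
    rw [← h]
    field_simp
    ring
  · have h := L.derivWeierstrassPExcept_sub ⟨0, zero_mem _⟩ z
    simp only [sub_zero] at h
    rw [← h]
    field_simp

/-- **Pole bound for `xᵃ yᵇ`**: `(xᵃ yᵇ)(φ z) = z^{N − 2a − 3b} Pᵃ Qᵇ / z^N` for `z ≠ 0` when
`2a + 3b ≤ N`. [folklore] -/
theorem eval_monomial_eq_div {P Q : ℂ → ℂ}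
    (hPQ : ∀ z : ℂ, z ≠ 0 → ℘[L] z = P z / z ^ 2 ∧ ℘'[L] z / 2 = Q z / z ^ 3) {a b N : ℕ}
    (h : 2 * a + 3 * b ≤ N) {z : ℂ} (hz : z ≠ 0) :
    eval (phi L z) (X 0 ^ a * X 1 ^ b) =
      z ^ (N - (2 * a + 3 * b)) * (P z ^ a * Q z ^ b) / z ^ N := by
  obtain ⟨d, rfl⟩ := Nat.exists_eq_add_of_le h
  have hz2 : z ^ (2 * a) * z ^ (3 * b) ≠ 0 := mul_ne_zero (pow_ne_zero _ hz) (pow_ne_zero _ hz)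
  obtain ⟨hP, hQ⟩ := hPQ z hz
  simp only [map_mul, map_pow, eval_X, phi_apply_zero, phi_apply_one]
  rw [hP, hQ, Nat.add_sub_cancel_left, div_pow, div_pow, ← pow_mul, ← pow_mul, div_mul_div_comm,
    eq_div_iff (pow_ne_zero _ hz), div_mul_eq_mul_div, div_eq_iff hz2]
  ring

/-- The vanishing order of `c · zⁿ · u(z)` at `0` is exactly `n` when `c ≠ 0`, `u(0) ≠ 0`.
[folklore] -/
theorem analyticOrderAt_const_mul_pow_mul {u : ℂ → ℂ} (hu : AnalyticAt ℂ u 0) (hu0 : u 0 ≠ 0)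
    {c : ℂ} (hc : c ≠ 0) (n : ℕ) : analyticOrderAt (fun z => c * (z ^ n * u z)) 0 = n := by
  have hF : AnalyticAt ℂ (fun z => c * (z ^ n * u z)) 0 := by fun_prop
  rw [hF.analyticOrderAt_eq_natCast]
  refine ⟨fun z => c * u z, by fun_prop, mul_ne_zero hc hu0, ?_⟩
  filter_upwards with z
  simp only [sub_zero, smul_eq_mul]
  ring

/-- The vanishing order of a finite sum of analytic germs with pairwise distinct (finite) orders
is the minimum of the orders. [folklore] -/
theorem analyticOrderAt_finset_sum {ι : Type*} (s : Finset ι) (f : ι → ℂ → ℂ) (z₀ : ℂ)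
    (hne : ∀ i ∈ s, ∀ j ∈ s, i ≠ j → analyticOrderAt (f i) z₀ ≠ ⊤ →
      analyticOrderAt (f i) z₀ ≠ analyticOrderAt (f j) z₀) :
    analyticOrderAt (fun z => ∑ i ∈ s, f i z) z₀ = s.inf fun i => analyticOrderAt (f i) z₀ := by
  classical
  induction s using Finset.induction_on with
  | empty => simpa using analyticOrderAt_eq_top.mpr (by simp)
  | insert j s hj ih =>
    rw [Finset.inf_insert]
    simp only [Finset.sum_insert hj]
    have ih' := ih fun i hi i' hi' => hne i (Finset.mem_insert_of_mem hi) i'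
      (Finset.mem_insert_of_mem hi')
    by_cases htop : analyticOrderAt (f j) z₀ = ⊤
    · have hz : ∀ᶠ z in 𝓝 z₀, f j z = 0 := analyticOrderAt_eq_top.mp htop
      have heq : (fun z => f j z + ∑ i ∈ s, f i z) =ᶠ[𝓝 z₀] fun z => ∑ i ∈ s, f i z := by
        filter_upwards [hz] with z hz
        rw [hz, zero_add]
      rw [analyticOrderAt_congr heq, ih', htop, top_inf_eq]
    · have hne' : analyticOrderAt (f j) z₀ ≠ analyticOrderAt (fun z => ∑ i ∈ s, f i z) z₀ := by
        rw [ih']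
        rcases s.eq_empty_or_nonempty with hs | hs
        · simp [hs, htop]
        · obtain ⟨i, hi, heq⟩ := Finset.exists_mem_eq_inf s hs fun i => analyticOrderAt (f i) z₀
          rw [heq]
          exact hne j (Finset.mem_insert_self j s) i (Finset.mem_insert_of_mem hi)
            (fun h => hj (h ▸ hi)) htop
      have := analyticOrderAt_add_of_ne hne'
      rw [← ih']
      convert this using 2
      rfl

/-- **Independence by pole orders.** If the polynomials `m i` pull back along `φ` to
`z^{e i} uᵢ(z) / z^N` near `0` with `uᵢ(0) ≠ 0` and pairwise distinct `e i`, then a non-trivial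
combination `Σ cᵢ m i` does not vanish identically on `E_L`: its regular germ `Σ cᵢ z^{e i} uᵢ`
has the finite vanishing order `min {e i | cᵢ ≠ 0}` at `0`, whereas it would vanish on a punctured
neighbourhood of `0` (`Λ` is discrete). [folklore] -/
theorem exists_eval_ne_zero {N : ℕ} (m : Fin N → MvPolynomial (Fin 2) ℂ) (u : Fin N → ℂ → ℂ)
    (e : Fin N → ℕ) (hu : ∀ i, AnalyticAt ℂ (u i) 0) (hu0 : ∀ i, u i 0 ≠ 0)
    (he : Function.Injective e)
    (hm : ∀ i, ∀ z : ℂ, z ≠ 0 → eval (phi L z) (m i) = z ^ e i * u i z / z ^ N)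
    (c : Fin N → ℂ) (hc : c ≠ 0) :
    ∃ z : ℂ, z ∉ L.lattice ∧ eval (phi L z) (∑ i, c i • m i) ≠ 0 := by
  by_contra! H
  set F : ℂ → ℂ := fun z => ∑ i, c i * (z ^ e i * u i z) with hFdef
  have hord : analyticOrderAt F 0 =
      Finset.univ.inf fun i => analyticOrderAt (fun z => c i * (z ^ e i * u i z)) 0 := by
    refine analyticOrderAt_finset_sum _ _ _ fun i _ j _ hij hitop => ?_
    have hci : c i ≠ 0 := fun h0 => hitop (analyticOrderAt_eq_top.mpr (by simp [h0]))
    rw [analyticOrderAt_const_mul_pow_mul (hu i) (hu0 i) hci]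
    by_cases hcj : c j = 0
    · rw [analyticOrderAt_eq_top.mpr (by simp [hcj])]
      exact ENat.coe_ne_top _
    · rw [analyticOrderAt_const_mul_pow_mul (hu j) (hu0 j) hcj, Ne, Nat.cast_inj]
      exact fun h => hij (he h)
  obtain ⟨i₀, hi₀⟩ := Function.ne_iff.mp hc
  have hfin : analyticOrderAt F 0 ≠ ⊤ := by
    rw [hord]
    refine ne_top_of_le_ne_top ?_ (Finset.inf_le (Finset.mem_univ i₀))
    rw [analyticOrderAt_const_mul_pow_mul (hu i₀) (hu0 i₀) hi₀]
    exact ENat.coe_ne_top _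
  have hF0 : ∀ᶠ z in 𝓝[≠] (0 : ℂ), F z = 0 := by
    filter_upwards [mem_nhdsWithin_of_mem_nhds (L.compl_lattice_sdiff_singleton_mem_nhds 0),
      self_mem_nhdsWithin] with z hz1 hz2
    have hzL : z ∉ L.lattice := fun h => hz1 ⟨h, hz2⟩
    have h := H z hzL
    rw [map_sum] at h
    have h' : (∑ i, c i * (z ^ e i * u i z)) / z ^ N = 0 := by
      rw [← h, Finset.sum_div]
      refine Finset.sum_congr rfl fun i _ => ?_
      rw [smul_eval, hm i z hz2, mul_div_assoc]
    rw [div_eq_zero_iff] at h'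
    exact h'.resolve_right (pow_ne_zero _ hz2)
  have hFa : AnalyticAt ℂ F 0 := by
    rw [hFdef]
    fun_prop
  rcases hFa.eventually_eq_zero_or_eventually_ne_zero with h | h
  · exact hfin (analyticOrderAt_eq_top.mpr h)
  · obtain ⟨z, hz⟩ := (h.and hF0).exists
    exact hz.1 hz.2

end TorsPoly

/-! ### The stub -/

open TorsPoly in
/-- **Stub `stub_torsPolyExists` — the torsion polynomial by linear algebra.** For an algebraic
point `v` of `E_L` (`g₂, g₃ ∈ ℚ̄`) and `N ≥ 2` there is `G ∈ ℚ̄[x, y]`, not identically zero on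
`E_L`, whose pull-back `G(℘, ℘′/2)` has a pole of order `≤ N` at `0` and vanishes to order
`≥ N − 1` at `v`: a non-zero solution over the field `ℚ̄` of the `N − 1` linear Taylor conditions
`(Dᵏ G)(φ v) = 0` (`k < N − 1`, algebraic coefficients by `D = 2y∂ₓ + (3x² + A)∂_y`) in the
`N`-dimensional space spanned by `xᵃ` (`2a ≤ N`) and `xᵃ y` (`2a + 3 ≤ N`), whose pull-backs have
the distinct pole orders `0, 2, 3, …, N`. [cite: WhittakerWatson1927, §20.5]
[cite: SilvermanAEC2009, III.3.5] -/
theorem stub_torsPolyExists (L : PeriodPair) (h₂ : IsAlgebraic ℚ L.g₂) (h₃ : IsAlgebraic ℚ L.g₃)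
    {v : ℂ} (hv : IsAlgPt L v) {N : ℕ} (hN : 2 ≤ N) :
    ∃ G : MvPolynomial (Fin 2) ℂ, HasAlgCoeffs G ∧
      (∃ z : ℂ, z ∉ L.lattice ∧ eval (phi L z) G ≠ 0) ∧
      (∃ F : ℂ → ℂ, AnalyticAt ℂ F 0 ∧ ∀ᶠ z in 𝓝[≠] (0 : ℂ), eval (phi L z) G = F z / z ^ N) ∧
      (∃ q : ℂ → ℂ, AnalyticAt ℂ q v ∧ ∀ᶠ z in 𝓝 v, eval (phi L z) G = (z - v) ^ (N - 1) * q z) := by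
  classical
  have _ := h₃
  obtain ⟨D, hDalg, hD⟩ := exists_opD L h₂
  obtain ⟨P, Q, hP, hQ, hP0, hQ0, hPQ⟩ := exists_germs L
  -- the monomials `x^{a i} y^{b i}`, `i < N`, of pole orders `2 a i + 3 b i ∈ {0, 2, 3, …, N}`
  set a : Fin N → ℕ := fun i => if (i : ℕ) % 2 = 0 then (i : ℕ) / 2 - 1 else ((i : ℕ) + 1) / 2
    with ha
  set b : Fin N → ℕ := fun i => if (i : ℕ) % 2 = 0 ∧ 0 < (i : ℕ) then 1 else 0 with hb
  have hab : ∀ i, 2 * a i + 3 * b i ≤ N := fun i => by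
    have := i.isLt
    simp only [ha, hb]
    split_ifs <;> omega
  have hinj : Function.Injective fun i => N - (2 * a i + 3 * b i) := by
    intro i j hij
    have hi := hab i
    have hj := hab j
    have := i.isLt
    have := j.isLt
    apply Fin.ext
    simp only [ha, hb] at hij hi hj
    split_ifs at hij hi hj <;> omega
  set m : Fin N → MvPolynomial (Fin 2) ℂ := fun i => X 0 ^ a i * X 1 ^ b i with hmdef
  have hmalg : ∀ i, HasAlgCoeffs (m i) := fun i =>
    ((hasAlgCoeffs_X 0).pow _).mul ((hasAlgCoeffs_X 1).pow _)
  have hm : ∀ i, ∀ z : ℂ, z ≠ 0 → eval (phi L z) (m i) =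
      z ^ (N - (2 * a i + 3 * b i)) * (P z ^ a i * Q z ^ b i) / z ^ N :=
    fun i z hz => eval_monomial_eq_div L hPQ (hab i) hz
  -- the Taylor functionals `(Dᵏ m_i)(φ v) ∈ ℚ̄`, as a matrix over the field `K = ℚ̄`
  have hT : ∀ (k : ℕ) (i : Fin N), IsAlgebraic ℚ (eval (phi L v) ((D ^ k) (m i))) := fun k i =>
    (hasAlgCoeffs_pow_apply hDalg (hmalg i) k).isAlgebraic_eval hv.2
  set K : IntermediateField ℚ ℂ := algebraicClosure ℚ ℂ with hK
  let Tm : Matrix (Fin (N - 1)) (Fin N) K :=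
    Matrix.of fun k i => ⟨eval (phi L v) ((D ^ (k : ℕ)) (m i)), mem_algebraicClosure_iff.mpr (hT k i)⟩
  have hlt : Module.finrank K (Fin (N - 1) → K) < Module.finrank K (Fin N → K) := by
    simp only [Module.finrank_fin_fun]
    omega
  obtain ⟨c, hcker, hc0⟩ :=
    (Submodule.ne_bot_iff _).mp (LinearMap.ker_ne_bot_of_finrank_lt (f := Tm.mulVecLin) hlt)
  set cc : Fin N → ℂ := fun i => (c i : ℂ) with hcc
  have hcc0 : cc ≠ 0 := by
    obtain ⟨i, hi⟩ := Function.ne_iff.mp hc0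
    exact Function.ne_iff.mpr ⟨i, by simpa [hcc] using hi⟩
  refine ⟨∑ i : Fin N, cc i • m i, ?_, ?_, ?_, ?_⟩
  · exact hasAlgCoeffs_finsetSum _ _ fun i _ =>
      HasAlgCoeffs.smul (mem_algebraicClosure_iff.mp (c i).2) (hmalg i)
  · exact exists_eval_ne_zero L m (fun i z => P z ^ a i * Q z ^ b i)
      (fun i => N - (2 * a i + 3 * b i)) (fun i => by fun_prop)
      (fun i => mul_ne_zero (pow_ne_zero _ (by simp [hP0])) (pow_ne_zero _ (by simp [hQ0])))
      hinj hm cc hcc0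
  · refine ⟨fun z => ∑ i : Fin N, cc i * (z ^ (N - (2 * a i + 3 * b i)) * (P z ^ a i * Q z ^ b i)),
      by fun_prop, ?_⟩
    filter_upwards [self_mem_nhdsWithin] with z hz
    rw [map_sum, Finset.sum_div]
    refine Finset.sum_congr rfl fun i _ => ?_
    rw [smul_eval, hm i z hz]
    exact (mul_div_assoc _ _ _).symm
  · have hker : ∀ k : Fin (N - 1),
        ∑ i : Fin N, cc i * eval (phi L v) ((D ^ (k : ℕ)) (m i)) = 0 := by
      intro k
      have h1 : (Tm.mulVecLin c) k = 0 := by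
        rw [LinearMap.mem_ker.mp hcker]; rfl
      rw [Matrix.mulVecLin_apply, Matrix.mulVec, dotProduct] at h1
      have h2 := congr_arg ((↑) : K → ℂ) h1
      push_cast at h2
      rw [← h2]
      refine Finset.sum_congr rfl fun i _ => ?_
      simp only [Tm, Matrix.of_apply, hcc]
      ring
    have hle : ((N - 1 : ℕ) : ℕ∞) ≤
        analyticOrderAt (fun w => eval (phi L w) (∑ i : Fin N, cc i • m i)) v := by
      refine le_analyticOrderAt_eval_phi L hD hv.1 (N - 1) _ fun k hk => ?_
      rw [map_sum, map_sum]
      simp only [map_smul, smul_eval]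
      exact hker ⟨k, hk⟩
    obtain ⟨q, hq, hfq⟩ := (natCast_le_analyticOrderAt (analyticAt_eval_phi L _ hv.1)).mp hle
    exact ⟨q, hq, hfq.mono fun z hz => by rw [hz, smul_eq_mul]⟩

end TorsionLayer

end Summit.KontsevichZagierPeriods.SymplecticScissors.RealOnePeriodRelations
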